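import Literature.AnabelianGeometry.EtaleTheta.SettingModelSec2Hyps
import HarnessLib

/-!
# The clause "`Π^tp_{Y_N} ⊇ Ker(Π^tp_Y ↠ (Π^tp_Y)^ell)`" of `ThetaSetting.Sec2Hyps` is independent of the
# [EtTh] §1 root interface EVEN GIVEN `hYcl`: the FINER root model with a twisted `Y`-lattice (no new Prop facts)

Mochizuki, *The étale theta function …*, Publ. RIMS **45** (2009) [EtTh], §1 p. 13 ("an open immersion
`G_{K_N} ↪ (Π^tp_Y)^ell/N·(Δ^tp_Y)^ell` the image of which … determines a Galois covering `Y_N → Y`", whence in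
print `Π^tp_{Y_N} ⊇ Ker(Π^tp_Y ↠ (Π^tp_Y)^ell)` by construction) [cite: MochizukiEtTh2009, §1 p.13]; pp. 12–13
("`1 → Δ_Θ → (Δ^tp_Y)^Θ → (Δ^tp_Y)^ell → 1` … abelian profinite groups" = the closedness binder `hYcl`,
GAP-LEDGER G-w4d021-2); Def. 2.5 p. 39 ("`K = K̈`").

abc-iut cell, layer L2 / K-L6 slice (bundle `ThetaSetting.Sec2Hyps`, FACT-LIST F-2511), seat abc-iut-w6-d092
(gen 5); sequel to `SettingModelYTwist.lean` (same seat), which refutes the universal closure of clause (b)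
`Sec2Hyps.ker_toEll_le_GtpYN` over {root `ThetaSetting`, guard `IsEtThOrigin`, clause (a) "`K = K̈`"} at a variant of
the DISCRETE root model — where the consumers' other standing `D`-level binder `hYcl`
(`(Δ^tp_Y ↦ Π_X)⁻ ≤ Δ^tp_Y ⊔ [[Δ_X,Δ_X],Δ_X]⁻`) FAILS (abc-iut-L2-t1 `SettingModelIndependence.hYcl_not_derivable`).
THIS FILE closes that loophole at abc-iut-L2-t1's FINER root model `ThetaSetting.model₂ p` (`SettingModel2.lean`:
`Π^tp_X := (F̂₂ ×_Ẑ ℤ) × G_{ℚ_p}`, `Y_N`/`Z_N` from the profinite level maps `ĥ_N : F̂₂ → Heis(ℤ/N)`; `hYcl` HOLDS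
there, `hYcl_model₂`): replace the `Y`-lattice at the levels `4 ∣ N` by

  `Δ'^tp_{Y_N} := Ker pr₂ ∩ ĥ_N⁻¹ {x = 0, y ≡ 0 (mod N/2), z ≡ 0 (mod 2)}`   (`heisT`, `dYT`, `dY'`, `YNT`)

(the level-`N` shadow of `SettingModelYTwist`'s `{x = 0, N/2 ∣ y, 2 ∣ z}`), keep `Z_N`, `q_X = p²`, `K_N`, the
theta quotients. Then (`ThetaSetting.model₂Twist p`): every root axiom holds (normality since `4 ∣ N`; index
`(N/2)·2 = N` in `Δ^tp_Y` via `(y mod N/2, z mod 2)`; antitone by the arithmetic `M ∣ N, 4 ∤ M, 4 ∣ N ⇒ M ∣ N/2`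
and the uniqueness of ring maps `ℤ/N → ℤ/m` (`RingHom.ext_zmod`); `[Δ'^tp_{Y_N} : Δ^tp_{Z_N}] = N` from
`[Δ^tp_Y : Δ^tp_{Z_N}] = N²` by multiplicativity of indices); the guard, `hYcl`, `Compat` and clause (a) hold;
but the graph element of `⁅a, b⁆` (`ĥ_4 = (0,0,1)`) lies in `Ker(Π^tp_X ↠ (Π^tp_X)^ell) ∩ Π^tp_Y` and not in
`Π'^tp_{Y_4}`. Hence **`ThetaSetting.not_forall_ker_toEll_inf_GtpY_le_GtpYN_of_hYcl`**:
`¬ ∀ D, D.IsEtThOrigin → hYcl D → D.Kdd = D.K → ∀ N, Ker(↠ell) ⊓ Π^tp_Y ≤ Π^tp_{Y_N}` and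
**`ThetaSetting.kerClause_independent_hYcl`** (`model₂ p` ⊨ (b), `model₂Twist p` ⊨ ¬(b), both ⊨ guard ∧ hYcl ∧ (a)).
READING (K-L6): clause (b) is not a lemma of {root, guard, `hYcl`, (a)} — i.e. of ALL the `D`-level standing
binders the §2 consumers carry; `E`-level binders (`Prop15iii`, `X̲̲`-data, cusp labels, theta cocycles) are
root-vacuous (`KummerData` is empty at the root models) and are not claimed to be tested. HONEST LIMITS:
independence evidence about OUR typed interface only; nothing of [EtTh] asserted or denied; no side taken on
[IUTchIII] Cor. 3.12. No instances on existing types; no Prop facts; `model₂Twist` is an explicit inhabitant of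
the existing structure `ThetaSetting p`.
-/

noncomputable section

namespace Literature.AnabelianGeometry.EtaleTheta.SettingModel

open Literature.AnabelianGeometry.SemiGraphs IntermediateField
open Function
open scoped commutatorElement

/-! ### Arithmetic (as in `SettingModelYTwist`, private there) -/

/-- `M ∣ N`, `4 ∤ M`, `4 ∣ N ⇒ M ∣ N/2`. [folklore] -/
private theorem dvd_div_two_of_not_four_dvd' {M N : ℕ} (hMN : M ∣ N) (hM : ¬ 4 ∣ M) (hN : 4 ∣ N) :
    M ∣ N / 2 := by
  obtain ⟨k, rfl⟩ := hN
  have h42 : 4 * k / 2 = 2 * k := by omega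
  rw [h42]
  have h4k : 4 * k = 2 * (2 * k) := by ring
  rcases Nat.even_or_odd M with ⟨m, rfl⟩ | hodd
  · have hm2 : ¬ 2 ∣ m := fun ⟨t, ht⟩ => hM ⟨t, by omega⟩
    have hcop : Nat.Coprime m 2 := ((Nat.Prime.coprime_iff_not_dvd Nat.prime_two).mpr hm2).symm
    have h1 : 2 * m ∣ 2 * (2 * k) := by rw [← h4k, two_mul]; exact hMN
    have h3 : m ∣ k := hcop.dvd_of_dvd_mul_left (Nat.dvd_of_mul_dvd_mul_left two_pos h1)
    rw [← two_mul]
    exact Nat.mul_dvd_mul_left 2 h3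
  · have hM2 : ¬ 2 ∣ M := by
      obtain ⟨m, rfl⟩ := hodd
      omega
    have hcop : Nat.Coprime M 2 := ((Nat.Prime.coprime_iff_not_dvd Nat.prime_two).mpr hM2).symm
    rw [h4k] at hMN
    exact hcop.dvd_of_dvd_mul_left hMN

/-- `M ∣ N`, `2 ∣ M ⇒ M/2 ∣ N/2`. [folklore] -/
private theorem div_two_dvd_div_two' {M N : ℕ} (hMN : M ∣ N) (hM : 2 ∣ M) : M / 2 ∣ N / 2 := by
  obtain ⟨t, rfl⟩ := hMN
  obtain ⟨m, rfl⟩ := hM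
  rw [Nat.mul_assoc, Nat.mul_div_cancel_left _ two_pos, Nat.mul_div_cancel_left _ two_pos]
  exact Dvd.intro t rfl

/-- `4 ∣ N ⇒ 2 ∣ N`. [folklore] -/
private theorem two_dvd_of_four_dvd' {N : ℕ} (h : 4 ∣ N) : 2 ∣ N := dvd_trans ⟨2, rfl⟩ h

/-- Two ring maps out of `ℤ/N` into `ℤ/m` agree (`RingHom.ext_zmod`), pointwise. [folklore] -/
private theorem zmod_ringHom_apply_eq {N m : ℕ} (f g : ZMod N →+* ZMod m) (y : ZMod N) : f y = g y :=
  RingHom.congr_fun (RingHom.ext_zmod f g) y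

/-! ### The twisted level `{x = 0, y ≡ 0 (N/2), z ≡ 0 (2)} ≤ Heis (ℤ/N)` -/

/-- **The twisted level in `Heis (ℤ/N)`** (`N` even): `x = 0`, `y ↦ 0` in `ℤ/(N/2)`, `z ↦ 0` in `ℤ/2` — the
reduction mod `N` of `SettingModelYTwist.heisYT`. [cite: MochizukiEtTh2009, §1 p.13] -/
def heisT (N : ℕ) (h2 : 2 ∣ N) : Subgroup (Heis (ZMod N)) where
  carrier := {h | h.x = 0 ∧ ZMod.castHom (Nat.div_dvd_of_dvd h2) (ZMod (N / 2)) h.y = 0 ∧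
    ZMod.castHom h2 (ZMod 2) h.z = 0}
  one_mem' := ⟨rfl, by simp, by simp⟩
  mul_mem' := by
    rintro g h ⟨hg, hg', hg''⟩ ⟨hh, hh', hh''⟩
    refine ⟨by simp [hg, hh], ?_, ?_⟩
    · simp only [Heis.mul_y, map_add, hg', hh', add_zero]
    · simp only [Heis.mul_z, hg, zero_mul, add_zero, map_add, hg'', hh'']
  inv_mem' := by
    rintro g ⟨hg, hg', hg''⟩
    refine ⟨by simp [hg], ?_, ?_⟩
    · simp only [Heis.inv_y, map_neg, hg', neg_zero]
    · simp only [Heis.inv_z, hg, zero_mul, add_zero, map_neg, hg'', neg_zero]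

/-- For `4 ∣ N` the twisted level is normal: conjugation moves `z` by `x'·y`, and `y ↦ 0` in `ℤ/2` because
`y ↦ 0` in `ℤ/(N/2)` and `2 ∣ N/2`. [cite: MochizukiEtTh2009, §1 p.13] -/
theorem heisT_normal {N : ℕ} (h4 : 4 ∣ N) : (heisT N (two_dvd_of_four_dvd' h4)).Normal := by
  have h2 : 2 ∣ N := two_dvd_of_four_dvd' h4
  have h2c : 2 ∣ N / 2 := by obtain ⟨k, rfl⟩ := h4; exact ⟨k, by omega⟩
  refine ⟨fun g ⟨hg, hg', hg''⟩ h => ⟨by simp [hg], ?_, ?_⟩⟩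
  · have : (h * g * h⁻¹).y = g.y := by simp
    rw [this]; exact hg'
  · have : (h * g * h⁻¹).z = g.z + h.x * g.y := by simp [hg]; ring
    rw [this, map_add, hg'', zero_add, map_mul]
    have hy2 : ZMod.castHom h2 (ZMod 2) g.y = 0 := by
      rw [zmod_ringHom_apply_eq (ZMod.castHom h2 (ZMod 2))
        ((ZMod.castHom h2c (ZMod 2)).comp (ZMod.castHom (Nat.div_dvd_of_dvd h2) (ZMod (N / 2)))) g.y,
        RingHom.comp_apply, hg', map_zero]
    rw [hy2, mul_zero]

/-! ### The twisted `Y`-lattice in the fibre product `Γ = F̂₂ ×_Ẑ ℤ` -/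

/-- `Δ'^tp_{Y_N} := Ker pr₂ ∩ ĥ_N⁻¹(twisted level)` (`N` even). [cite: MochizukiEtTh2009, §1 p.13] -/
def dYT (N : ℕ+) (h2 : 2 ∣ (N : ℕ)) : Subgroup Gfp := gfpSnd.ker ⊓ (heisT N h2).comap (levelHom N)

/-- The twisted `Y`-family of the finer model: `dYT` where `4 ∣ N`, the original `dY` elsewhere.
[cite: MochizukiEtTh2009, §1 p.13] -/
def dY' (N : ℕ+) : Subgroup Gfp :=
  if h : 4 ∣ (N : ℕ) then dYT N (two_dvd_of_four_dvd' h) else dY N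

/-- [cite: MochizukiEtTh2009, §1 p.13] -/
theorem dY'_of_dvd {N : ℕ+} (h : 4 ∣ (N : ℕ)) : dY' N = dYT N (two_dvd_of_four_dvd' h) := dif_pos h

/-- [cite: MochizukiEtTh2009, §1 p.13] -/
theorem dY'_of_not_dvd {N : ℕ+} (h : ¬ 4 ∣ (N : ℕ)) : dY' N = dY N := dif_neg h

/-- `Δ'^tp_{Y_N} ≤ Ker pr₂`. [cite: MochizukiEtTh2009, §1 p.13] -/
theorem dY'_le (N : ℕ+) : dY' N ≤ gfpSnd.ker := by
  by_cases h : 4 ∣ (N : ℕ)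
  · rw [dY'_of_dvd h]; exact fun _ hγ => (Subgroup.mem_inf.mp hγ).1
  · rw [dY'_of_not_dvd h]; exact dY_le N

/-- `Δ^tp_{Z_N} ≤ Δ'^tp_{Y_N}`. [cite: MochizukiEtTh2009, §1 p.14] -/
theorem dZ_le_dY' (N : ℕ+) : dZ N ≤ dY' N := by
  by_cases h : 4 ∣ (N : ℕ)
  · rw [dY'_of_dvd h]
    intro γ hγ
    obtain ⟨h1, h2⟩ := Subgroup.mem_inf.mp hγ
    rw [MonoidHom.mem_ker] at h2
    refine Subgroup.mem_inf.mpr ⟨h1, Subgroup.mem_comap.mpr ?_⟩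
    rw [h2]
    exact (heisT N _).one_mem
  · rw [dY'_of_not_dvd h]; exact dZ_le_dY N

/-- `Δ'^tp_{Y_1} = Ker pr₂`. [cite: MochizukiEtTh2009, §1 p.14] -/
theorem dY'_one : dY' 1 = gfpSnd.ker := by
  rw [dY'_of_not_dvd (by decide), dY_one]

/-- `Δ'^tp_{Y_N}` is normal. [cite: MochizukiEtTh2009, §1 p.14] -/
theorem dY'_normal (N : ℕ+) : (dY' N).Normal := by
  by_cases h : 4 ∣ (N : ℕ)
  · rw [dY'_of_dvd h]
    haveI := heisT_normal h
    haveI : ((heisT N (two_dvd_of_four_dvd' h)).comap (levelHom N)).Normal := Subgroup.Normal.comap inferInstance _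
    exact Subgroup.normal_inf_normal _ _
  · rw [dY'_of_not_dvd h]; exact dY_normal N

/-- `Δ'^tp_{Y_N}` is open. [cite: MochizukiEtTh2009, §1 p.13] -/
theorem isOpen_dY' (N : ℕ+) : IsOpen (dY' N : Set Gfp) := by
  by_cases h : 4 ∣ (N : ℕ)
  · rw [dY'_of_dvd h, dYT, Subgroup.coe_inf, Subgroup.coe_comap]
    exact isOpen_ker_gfpSnd.inter ((isOpen_discrete _).preimage (levelHom_continuous N))
  · rw [dY'_of_not_dvd h]; exact isOpen_dY N

/-- Compatibility of the level maps on `Γ` (abc-iut-L2-t1's `map_hHat_of_dvd`). [cite: MochizukiEtTh2009, §1 p.18] -/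
private theorem levelHom_map_of_dvd {M N : ℕ+} (h : (M : ℕ) ∣ N) (γ : Gfp) :
    Heis.map (ZMod.castHom h (ZMod M)) (levelHom N γ) = levelHom M γ :=
  map_hHat_of_dvd h (γ : F₂hatT × Multiplicative ℤ).1

/-- **The twisted family is antitone**: `M ∣ N ⇒ Δ'^tp_{Y_N} ≤ Δ'^tp_{Y_M}` (cases on `4 ∣ M`, `4 ∣ N`).
[cite: MochizukiEtTh2009, §1 p.18] -/
theorem dY'_anti {M N : ℕ+} (h : (M : ℕ) ∣ N) : dY' N ≤ dY' M := by
  by_cases hM : 4 ∣ (M : ℕ)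
  · have hN : 4 ∣ (N : ℕ) := hM.trans h
    rw [dY'_of_dvd hM, dY'_of_dvd hN]
    intro γ hγ
    obtain ⟨h1, h2⟩ := Subgroup.mem_inf.mp hγ
    obtain ⟨hx, hy, hz⟩ := Subgroup.mem_comap.mp h2
    have e := levelHom_map_of_dvd h γ
    refine Subgroup.mem_inf.mpr ⟨h1, Subgroup.mem_comap.mpr ⟨?_, ?_, ?_⟩⟩
    · show (levelHom M γ).x = 0
      rw [← e, Heis.map_apply]; simp [hx]
    · show ZMod.castHom _ (ZMod (M / 2)) (levelHom M γ).y = 0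
      rw [← e, Heis.map_apply]
      show ZMod.castHom _ (ZMod (M / 2)) (ZMod.castHom h (ZMod M) (levelHom N γ).y) = 0
      rw [← RingHom.comp_apply,
        zmod_ringHom_apply_eq _ ((ZMod.castHom (div_two_dvd_div_two' h (two_dvd_of_four_dvd' hM))
          (ZMod (M / 2))).comp (ZMod.castHom (Nat.div_dvd_of_dvd (two_dvd_of_four_dvd' hN)) (ZMod (N / 2)))),
        RingHom.comp_apply, hy, map_zero]
    · show ZMod.castHom _ (ZMod 2) (levelHom M γ).z = 0
      rw [← e, Heis.map_apply]
      show ZMod.castHom _ (ZMod 2) (ZMod.castHom h (ZMod M) (levelHom N γ).z) = 0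
      rw [← RingHom.comp_apply, zmod_ringHom_apply_eq _ (ZMod.castHom (two_dvd_of_four_dvd' hN) (ZMod 2)), hz]
  · rw [dY'_of_not_dvd hM]
    by_cases hN : 4 ∣ (N : ℕ)
    · rw [dY'_of_dvd hN]
      intro γ hγ
      obtain ⟨h1, h2⟩ := Subgroup.mem_inf.mp hγ
      obtain ⟨hx, hy, -⟩ := Subgroup.mem_comap.mp h2
      have e := levelHom_map_of_dvd h γ
      refine Subgroup.mem_inf.mpr ⟨h1, Subgroup.mem_comap.mpr ⟨?_, ?_⟩⟩
      · show (levelHom M γ).x = 0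
        rw [← e, Heis.map_apply]; simp [hx]
      · show (levelHom M γ).y = 0
        rw [← e, Heis.map_apply]
        show ZMod.castHom h (ZMod M) (levelHom N γ).y = 0
        rw [zmod_ringHom_apply_eq _ ((ZMod.castHom (dvd_div_two_of_not_four_dvd' h hM hN) (ZMod M)).comp
          (ZMod.castHom (Nat.div_dvd_of_dvd (two_dvd_of_four_dvd' hN)) (ZMod (N / 2)))),
          RingHom.comp_apply, hy, map_zero]
    · rw [dY'_of_not_dvd hN]; exact dY_anti h

/-- `ĥ_N` of the graph element of `b^k · ⁅a,b⁆^m` is `(0, k, m)`. [cite: MochizukiEtTh2009, §1 p.12] -/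
private theorem levelHom_gfpOf_bk_cm (N : ℕ+) (k m : ℤ) :
    levelHom N (gfpOf (FreeGroup.of 1 ^ k * ⁅FreeGroup.of (0 : Fin 2), FreeGroup.of 1⁆ ^ m)) =
      ⟨0, (k : ZMod N), (m : ZMod N)⟩ := by
  rw [levelHom_gfpOf, map_mul, map_zpow, map_zpow, heisHom_of_one, heisHom_commutator,
    Heis.zpow_eq_of_mul_eq_zero _ (by simp), Heis.zpow_eq_of_mul_eq_zero _ (by simp), Heis.map_apply]
  ext <;> simp

/-- The graph element of `b^k · ⁅a,b⁆^m` lies in `Ker pr₂`. [cite: MochizukiEtTh2009, §1 p.12] -/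
private theorem gfpOf_bk_cm_mem (k m : ℤ) :
    gfpOf (FreeGroup.of 1 ^ k * ⁅FreeGroup.of (0 : Fin 2), FreeGroup.of 1⁆ ^ m) ∈ gfpSnd.ker := by
  show expA (FreeGroup.of 1 ^ k * ⁅FreeGroup.of (0 : Fin 2), FreeGroup.of 1⁆ ^ m) = 1
  rw [expA_apply, map_mul, map_zpow, map_zpow, heisHom_of_one, heisHom_commutator,
    Heis.zpow_eq_of_mul_eq_zero _ (by simp), Heis.zpow_eq_of_mul_eq_zero _ (by simp)]
  simp

/-- **`[Δ^tp_Y : Δ'^tp_{Y_N}] = (N/2)·2 = N`** (twisted level, `N` even): `(y mod N/2, z mod 2)` is a surjection of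
`Ker pr₂` onto `ℤ/(N/2) × ℤ/2` with kernel `Δ'^tp_{Y_N}`. [cite: MochizukiEtTh2009, §1 p.16] -/
theorem relIndex_dYT (N : ℕ+) (h2 : 2 ∣ (N : ℕ)) : (dYT N h2).relIndex gfpSnd.ker = N := by
  have hc : (N : ℕ) / 2 ∣ (N : ℕ) := Nat.div_dvd_of_dvd h2
  let f : gfpSnd.ker →* Multiplicative (ZMod ((N : ℕ) / 2)) × Multiplicative (ZMod 2) :=
    { toFun := fun γ => (Multiplicative.ofAdd (ZMod.castHom hc (ZMod ((N : ℕ) / 2)) (levelHom N γ.1).y),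
        Multiplicative.ofAdd (ZMod.castHom h2 (ZMod 2) (levelHom N γ.1).z))
      map_one' := by simp
      map_mul' := fun γ δ => by
        have hx : (levelHom N γ.1).x = 0 := levelHom_x_eq_zero γ.2
        refine Prod.ext ?_ ?_
        · show Multiplicative.ofAdd (ZMod.castHom hc (ZMod ((N : ℕ) / 2)) (levelHom N (γ.1 * δ.1)).y) = _
          rw [map_mul, Heis.mul_y, map_add, ofAdd_add]; rfl
        · show Multiplicative.ofAdd (ZMod.castHom h2 (ZMod 2) (levelHom N (γ.1 * δ.1)).z) = _
          rw [map_mul, Heis.mul_z, hx, zero_mul, add_zero, map_add, ofAdd_add]; rfl }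
  have hker : (dYT N h2).subgroupOf gfpSnd.ker = f.ker := by
    ext γ
    rw [Subgroup.mem_subgroupOf, MonoidHom.mem_ker]
    constructor
    · intro h
      obtain ⟨-, hy, hz⟩ := Subgroup.mem_comap.mp (Subgroup.mem_inf.mp h).2
      exact Prod.ext (show Multiplicative.ofAdd _ = 1 by rw [hy]; rfl) (show Multiplicative.ofAdd _ = 1 by rw [hz]; rfl)
    · intro h
      rw [Prod.ext_iff] at h
      obtain ⟨hy, hz⟩ := h
      refine Subgroup.mem_inf.mpr ⟨γ.2, Subgroup.mem_comap.mpr ⟨levelHom_x_eq_zero γ.2, ?_, ?_⟩⟩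
      · exact ofAdd_eq_one.mp hy
      · exact ofAdd_eq_one.mp hz
  have hsurj : Surjective f := by
    rintro ⟨s, t⟩
    obtain ⟨k, hk⟩ := ZMod.intCast_surjective (Multiplicative.toAdd s)
    obtain ⟨m, hm⟩ := ZMod.intCast_surjective (Multiplicative.toAdd t)
    refine ⟨⟨_, gfpOf_bk_cm_mem k m⟩, Prod.ext ?_ ?_⟩
    · show Multiplicative.ofAdd (ZMod.castHom hc (ZMod ((N : ℕ) / 2)) (levelHom N (gfpOf _)).y) = s
      rw [levelHom_gfpOf_bk_cm, map_intCast, hk]; rfl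
    · show Multiplicative.ofAdd (ZMod.castHom h2 (ZMod 2) (levelHom N (gfpOf _)).z) = t
      rw [levelHom_gfpOf_bk_cm, map_intCast, hm]; rfl
  rw [Subgroup.relIndex, hker, Subgroup.index_ker, MonoidHom.range_eq_top.mpr hsurj, Subgroup.card_top,
    Nat.card_prod]
  show Nat.card (ZMod ((N : ℕ) / 2)) * Nat.card (ZMod 2) = N
  rw [Nat.card_zmod, Nat.card_zmod]
  exact Nat.div_mul_cancel h2

/-- **`[Δ^tp_Y : Δ'^tp_{Y_N}] = N`** for the twisted family. [cite: MochizukiEtTh2009, §1 p.16] -/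
theorem relIndex_dY' (N : ℕ+) : (dY' N).relIndex gfpSnd.ker = N := by
  by_cases h : 4 ∣ (N : ℕ)
  · rw [dY'_of_dvd h]; exact relIndex_dYT N _
  · rw [dY'_of_not_dvd h]; exact relIndex_dY N

/-- **`[Δ'^tp_{Y_N} : Δ^tp_{Z_N}] = N`**: by multiplicativity of indices along `Δ^tp_{Z_N} ≤ Δ'^tp_{Y_N} ≤ Δ^tp_Y`
and `[Δ^tp_Y : Δ^tp_{Z_N}] = N·N`. [cite: MochizukiEtTh2009, §1 p.14] -/
theorem relIndex_dZ_dY' (N : ℕ+) : (dZ N).relIndex (dY' N) = N := by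
  have hZY : (dZ N).relIndex gfpSnd.ker = N * N := by
    rw [← Subgroup.relIndex_mul_relIndex (dZ N) (dY N) gfpSnd.ker (dZ_le_dY N) (dY_le N), relIndex_dZ,
      relIndex_dY]
  have h := Subgroup.relIndex_mul_relIndex (dZ N) (dY' N) gfpSnd.ker (dZ_le_dY' N) (dY'_le N)
  rw [relIndex_dY', hZY] at h
  exact Nat.eq_of_mul_eq_mul_right N.pos h

/-- **The twist bites at `N = 4`**: the graph element of `⁅a,b⁆` (`ĥ_4 = (0,0,1)`, `z = 1 ≢ 0 (mod 2)`) is NOT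
in `Δ'^tp_{Y_4}`. [cite: MochizukiEtTh2009, §1 p.13] -/
theorem gfpOf_commutator_not_mem_dY'_four :
    gfpOf ⁅FreeGroup.of (0 : Fin 2), FreeGroup.of 1⁆ ∉ dY' 4 := by
  intro h
  rw [dY'_of_dvd (dvd_refl 4)] at h
  obtain ⟨-, -, hz⟩ := Subgroup.mem_comap.mp (Subgroup.mem_inf.mp h).2
  rw [levelHom_gfpOf, heisHom_commutator, Heis.map_apply] at hz
  simp only [map_one] at hz
  exact one_ne_zero hz

/-! ### The twisted coverings `Π'^tp_{Y_N} := Δ'^tp_{Y_N} × G_{K_N}` and the inhabitant `model₂Twist` -/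

variable (p : ℕ) [Fact p.Prime]

/-- `p² ∈ ℚ_p`. [folklore] -/
private theorem qModel_mem_bot₃ : qModel p ∈ (⊥ : IntermediateField ℚ_[p] (PadicAlgCl p)) :=
  pow_mem (IntermediateField.natCast_mem _ p) 2

/-- `p² ≠ 0`. [folklore] -/
private theorem qModel_ne_zero₃ : qModel p ≠ 0 :=
  pow_ne_zero 2 (Nat.cast_ne_zero.mpr (Fact.out : p.Prime).ne_zero)

/-- [folklore] -/
private theorem map_aug_prod₃ (A : Subgroup Gfp) (B : Subgroup (GQp p)) :
    (A.prod (B.comap (Gam.toGQp p).toMonoidHom)).map (curve₂ p).aug.toMonoidHom = B := by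
  ext σ
  constructor
  · rintro ⟨x, ⟨-, hx⟩, rfl⟩; exact hx
  · intro hσ; exact ⟨((1 : Gfp), (σ : Gam p)), ⟨A.one_mem, hσ⟩, rfl⟩

/-- [folklore] -/
private theorem prod_inf_deltaTemp₃ (A : Subgroup Gfp) (B : Subgroup (Gam p)) :
    A.prod B ⊓ (curve₂ p).aug.toMonoidHom.ker = A.prod ⊥ := by
  ext g
  rw [Subgroup.mem_inf, Subgroup.mem_prod, Subgroup.mem_prod, Subgroup.mem_bot]
  constructor
  · rintro ⟨⟨h1, -⟩, h3⟩; exact ⟨h1, (mem_deltaTemp₂_iff p g).mp h3⟩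
  · rintro ⟨h1, h2⟩; exact ⟨⟨h1, by rw [h2]; exact B.one_mem⟩, (mem_deltaTemp₂_iff p g).mpr h2⟩

/-- [folklore] -/
private theorem relIndex_prod_bot₃ (A' A : Subgroup Gfp) :
    ((A'.prod (⊥ : Subgroup (Gam p))).relIndex (A.prod ⊥)) = A'.relIndex A := by
  have h1 : ∀ B : Subgroup Gfp, B.prod (⊥ : Subgroup (Gam p)) = B.map (MonoidHom.inl Gfp (Gam p)) := by
    intro B; ext x; constructor
    · rintro ⟨hx1, hx2⟩; exact ⟨x.1, hx1, Prod.ext rfl ((Subgroup.mem_bot.mp hx2).symm)⟩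
    · rintro ⟨b, hb, rfl⟩; exact ⟨hb, Subgroup.mem_bot.mpr rfl⟩
  have hinj : Injective (MonoidHom.inl Gfp (Gam p)) := fun a b h => congrArg Prod.fst h
  have h2 := Subgroup.relIndex_comap (A'.map (MonoidHom.inl Gfp (Gam p))) (MonoidHom.inl Gfp (Gam p)) A
  rw [Subgroup.comap_map_eq_self_of_injective hinj] at h2
  rw [h1, h1, ← h2]

/-- **`Π'^tp_{Y_N} := Δ'^tp_{Y_N} × G_{K_N}`** (finer model, twisted `Y`-lattice). [cite: MochizukiEtTh2009, §1 p.13] -/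
def YNT (N : ℕ+) : Subgroup (PiTp₂ p) := (dY' N).prod (gKN p N)

/-- [cite: MochizukiEtTh2009, §1 p.14] -/
theorem YNT_one : YNT p 1 = (toZM₂ p).ker := by
  rw [ker_toZM₂, YNT, dY'_one, gKN, fieldKN_bot_one _ (qModel_mem_bot₃ p), IntermediateField.fixingSubgroup_bot,
    Subgroup.comap_top]

/-- [cite: MochizukiEtTh2009, §1 p.13] -/
theorem YNT_le (N : ℕ+) : YNT p N ≤ (toZM₂ p).ker := by
  rw [ker_toZM₂]; exact Subgroup.prod_mono (dY'_le N) le_top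

/-- [cite: MochizukiEtTh2009, §1 p.14] -/
theorem YNT_normal (N : ℕ+) : (YNT p N).Normal := by
  haveI := dY'_normal N
  haveI := fixingSubgroup_fieldKN_bot_normal _ (qModel_mem_bot₃ p) N
  haveI : (gKN p N).Normal := Subgroup.Normal.comap inferInstance _
  exact Subgroup.prod_normal _ _

/-- [cite: MochizukiEtTh2009, §1 p.13] -/
theorem isOpen_YNT (N : ℕ+) : IsOpen (YNT p N : Set (PiTp₂ p)) := by
  rw [YNT, Subgroup.coe_prod]; exact (isOpen_dY' N).prod (isOpen_discrete _)

/-- **The finer root model with the twisted `Y`-lattice** (`Π'^tp_{Y_N}` twisted at `4 ∣ N`; `K`, `q_X = p²`,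
`Π^tp_X ↠ Z`, the theta quotients, `Z_N` exactly as `ThetaSetting.model₂ p`). Consistency / independence
evidence only. [cite: MochizukiEtTh2009, §1 p.13] -/
abbrev _root_.Literature.AnabelianGeometry.EtaleTheta.ThetaSetting.model₂Twist : ThetaSetting p where
  toTemperedCurve := curve₂ p
  qX := qModel p
  qX_mem := qModel_mem_bot₃ p
  norm_qX_lt_one := (ThetaSetting.model p).norm_qX_lt_one
  qX_ne_zero := qModel_ne_zero₃ p
  sqrtqX := ((p : ℕ) : PadicAlgCl p)
  sqrtqX_sq := rfl
  toZ := toZM₂ p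
  toZ_surjective := toZM₂_surjective p
  isOpen_ker_toZ := isOpen_ker_toZM₂ p
  toZ_delta_surjective := toZM₂_delta_surjective p
  GtpTheta := GTheta₂ p
  toTheta := toThetaM₂ p
  continuous_toTheta := (ThetaSetting.model₂ p).continuous_toTheta
  toTheta_surjective := QuotientGroup.mk'_surjective _
  ker_toTheta := QuotientGroup.ker_mk' _
  GtpEll := GEll₂ p
  thetaToEll := thetaToEllM₂ p
  continuous_thetaToEll := (ThetaSetting.model₂ p).continuous_thetaToEll
  thetaToEll_surjective := (ThetaSetting.model₂ p).thetaToEll_surjective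
  ker_toEll := ker_toEllM₂ p
  ker_thetaToEll_comm := ker_thetaToEllM₂_comm p
  ker_thetaToEll_central := ker_thetaToEllM₂_central p
  GtpYN := YNT p
  GtpYN_one := YNT_one p
  GtpYN_le := YNT_le p
  map_aug_GtpYN N := map_aug_prod₃ p _ _
  GtpYN_normal := YNT_normal p
  isOpen_GtpYN := isOpen_YNT p
  GtpYN_anti M N h := Subgroup.prod_mono (dY'_anti h)
    (Subgroup.comap_mono (IntermediateField.fixingSubgroup_antitone (fieldKN_bot_mono _ (qModel_ne_zero₃ p) h)))
  relIndex_deltaYN N := by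
    rw [ker_toZM₂, YNT, prod_inf_deltaTemp₃, prod_inf_deltaTemp₃, relIndex_prod_bot₃, relIndex_dY']
  GtpZN := ZN₂ p
  GtpZN_le N := Subgroup.prod_mono (dZ_le_dY' N)
    (Subgroup.comap_mono (IntermediateField.fixingSubgroup_antitone (fieldKN_le_fieldJN _ ⊥ N)))
  map_aug_GtpZN N := map_aug_prod₃ p _ _
  GtpZN_normal := ZN₂_normal p
  isOpen_GtpZN := isOpen_ZN₂ p
  GtpZN_anti M N h := Subgroup.prod_mono (dZ_anti h)
    (Subgroup.comap_mono (IntermediateField.fixingSubgroup_antitone (fieldJN_bot_mono _ (qModel_ne_zero₃ p) h)))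
  relIndex_deltaZN N := by
    rw [ZN₂, YNT, prod_inf_deltaTemp₃, prod_inf_deltaTemp₃, relIndex_prod_bot₃, relIndex_dZ_dY']
  ker_toTheta_le_GtpZN N := by
    intro g hg'
    obtain ⟨hg, hgY⟩ := Subgroup.mem_inf.mp hg'
    rw [toThetaM₂, QuotientGroup.ker_mk'] at hg
    obtain ⟨h1, h2⟩ := hHat_eq_one_and_snd_eq_one_of_mem_KTheta₂ p hg N
    have hgY1 : g.1 ∈ gfpSnd.ker := dY'_le N (Subgroup.mem_prod.mp hgY).1
    refine Subgroup.mem_prod.mpr ⟨Subgroup.mem_inf.mpr ⟨hgY1, ?_⟩, ?_⟩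
    · rw [MonoidHom.mem_ker]; exact h1
    · show g.2 ∈ gJN p N
      rw [h2]; exact (gJN p N).one_mem

/-- `model₂Twist` satisfies the guard. [cite: MochizukiEtTh2009, §1 p.12] -/
theorem _root_.Literature.AnabelianGeometry.EtaleTheta.ThetaSetting.model₂Twist_isEtThOrigin :
    (ThetaSetting.model₂Twist p).IsEtThOrigin :=
  ThetaSetting.IsEtThOrigin.of_free (isFreeProfiniteOnTwo_deltaHat₂ p)

/-- `model₂Twist` satisfies `Compat`. [cite: MochizukiEtTh2009, §1 p.22] -/
theorem _root_.Literature.AnabelianGeometry.EtaleTheta.ThetaSetting.model₂Twist_compat :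
    (ThetaSetting.model₂Twist p).Compat :=
  (ThetaSetting.model₂Twist p).compat

/-- **`hYcl` HOLDS at `model₂Twist`** (its `Δ^tp_Y`, `Π^tp_X → Π_X`, `Δ_X` are those of `model₂ p`; abc-iut-L2-t1
`hYcl_model₂`). [cite: MochizukiEtTh2009, §1 p.12] -/
theorem hYcl_model₂Twist :
    ((ThetaSetting.model₂Twist p).DtpY.map (ThetaSetting.model₂Twist p).toHat.toMonoidHom).topologicalClosure ≤
      (ThetaSetting.model₂Twist p).DtpY.map (ThetaSetting.model₂Twist p).toHat.toMonoidHom ⊔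
        (⁅⁅(ThetaSetting.model₂Twist p).DeltaHat, (ThetaSetting.model₂Twist p).DeltaHat⁆,
          (ThetaSetting.model₂Twist p).DeltaHat⁆).topologicalClosure :=
  hYcl_model₂ p

/-- **Clause (a) "`K = K̈`" HOLDS at `model₂Twist`.** [cite: MochizukiEtTh2009, Def 2.5 p.39] -/
theorem model₂Twist_Kdd_eq : (ThetaSetting.model₂Twist p).Kdd = (ThetaSetting.model₂Twist p).K := by
  change fieldKN ⊥ (qModel p) 2 = ⊥
  exact fieldKN_bot_two_of_sq p (IntermediateField.natCast_mem _ p)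

/-- The graph element of `⁅a,b⁆` in `Π^tp_X = Γ × Γ_{arith}`. [cite: MochizukiEtTh2009, §1 p.12] -/
def commAB₂ : PiTp₂ p := (gfpOf ⁅FreeGroup.of (0 : Fin 2), FreeGroup.of 1⁆, 1)

/-- `commAB₂ ∈ Ker(Π^tp_X ↠ (Π^tp_X)^ell)`: at every level `ĥ_N(η⁅a,b⁆) = (0,0,1)` has `x = y = 0`
(abc-iut-L2-t1's `mem_KEll₂_iff`). [cite: MochizukiEtTh2009, §1 p.12] -/
theorem commAB₂_mem_KEll₂ : commAB₂ p ∈ KEll₂ p := by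
  refine (mem_KEll₂_iff p _).mpr ⟨fun N => ?_, rfl⟩
  change (hHat N (eta ⁅FreeGroup.of (0 : Fin 2), FreeGroup.of 1⁆)).x = 0 ∧
    (hHat N (eta ⁅FreeGroup.of (0 : Fin 2), FreeGroup.of 1⁆)).y = 0
  rw [hHat_eta, heisHom_commutator, Heis.map_apply]
  exact ⟨by simp, by simp⟩

/-- `commAB₂ ∈ Π^tp_Y = Ker(Π^tp_X ↠ Z)` (`a`-exponent sum `0`). [cite: MochizukiEtTh2009, §1 p.12] -/
theorem commAB₂_mem_ker_toZM₂ : commAB₂ p ∈ (toZM₂ p).ker := by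
  rw [ker_toZM₂]
  refine Subgroup.mem_prod.mpr ⟨?_, Subgroup.mem_top _⟩
  show expA ⁅FreeGroup.of (0 : Fin 2), FreeGroup.of 1⁆ = 1
  rw [expA_apply, heisHom_commutator]; rfl

/-- **`commAB₂ ∉ Π'^tp_{Y_4}`.** [cite: MochizukiEtTh2009, §1 p.13] -/
theorem commAB₂_not_mem_YNT_four : commAB₂ p ∉ YNT p 4 := fun h =>
  gfpOf_commutator_not_mem_dY'_four (Subgroup.mem_prod.mp h).1

/-- **Clause (b) of `Sec2Hyps` FAILS at `model₂Twist`**. [cite: MochizukiEtTh2009, §1 p.13] -/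
theorem not_ker_toEll_inf_GtpY_le_GtpYN_model₂Twist :
    ¬ ∀ N, ((ThetaSetting.model₂Twist p).thetaToEll.comp (ThetaSetting.model₂Twist p).toTheta).ker ⊓
      (ThetaSetting.model₂Twist p).GtpY ≤ (ThetaSetting.model₂Twist p).GtpYN N := by
  intro h
  have hmem : commAB₂ p ∈
      ((ThetaSetting.model₂Twist p).thetaToEll.comp (ThetaSetting.model₂Twist p).toTheta).ker ⊓
        (ThetaSetting.model₂Twist p).GtpY := by
    refine ⟨?_, commAB₂_mem_ker_toZM₂ p⟩
    change commAB₂ p ∈ ((thetaToEllM₂ p).comp (toThetaM₂ p)).ker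
    rw [ker_toEllM₂]
    exact commAB₂_mem_KEll₂ p
  exact commAB₂_not_mem_YNT_four p (h 4 hmem)

/-- **`model₂Twist` does NOT satisfy `Sec2Hyps`.** [cite: MochizukiEtTh2009, §1 p.13] -/
theorem _root_.Literature.AnabelianGeometry.EtaleTheta.ThetaSetting.not_sec2Hyps_model₂Twist :
    ¬ (ThetaSetting.model₂Twist p).Sec2Hyps :=
  fun h => not_ker_toEll_inf_GtpY_le_GtpYN_model₂Twist p h.ker_toEll_le_GtpYN

/-- **UNIVERSAL CLOSURE OF CLAUSE (b) REFUTED over {root, guard, `hYcl`, clause (a)}**: the clause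
"`Π^tp_{Y_N} ⊇ Ker(Π^tp_Y ↠ (Π^tp_Y)^ell)`" is NOT a consequence of the root interface, `IsEtThOrigin`, the
closedness binder `hYcl` (G-w4d021-2) and "`K = K̈`". Witness: `model₂Twist p`. [cite: MochizukiEtTh2009, §1 p.13] -/
theorem _root_.Literature.AnabelianGeometry.EtaleTheta.ThetaSetting.not_forall_ker_toEll_inf_GtpY_le_GtpYN_of_hYcl :
    ¬ ∀ D : ThetaSetting p, D.IsEtThOrigin →
      (D.DtpY.map D.toHat.toMonoidHom).topologicalClosure ≤
        D.DtpY.map D.toHat.toMonoidHom ⊔ (⁅⁅D.DeltaHat, D.DeltaHat⁆, D.DeltaHat⁆).topologicalClosure →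
      D.Kdd = D.K → ∀ N, (D.thetaToEll.comp D.toTheta).ker ⊓ D.GtpY ≤ D.GtpYN N :=
  fun h => not_ker_toEll_inf_GtpY_le_GtpYN_model₂Twist p
    (h (ThetaSetting.model₂Twist p) (ThetaSetting.model₂Twist_isEtThOrigin p) (hYcl_model₂Twist p)
      (model₂Twist_Kdd_eq p))

/-- **`Sec2Hyps` is not a theorem of {root, guard, `hYcl`, "`K = K̈`"}.** [cite: MochizukiEtTh2009, Def 2.5 p.39] -/
theorem _root_.Literature.AnabelianGeometry.EtaleTheta.ThetaSetting.not_forall_sec2Hyps_of_hYcl :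
    ¬ ∀ D : ThetaSetting p, D.IsEtThOrigin →
      (D.DtpY.map D.toHat.toMonoidHom).topologicalClosure ≤
        D.DtpY.map D.toHat.toMonoidHom ⊔ (⁅⁅D.DeltaHat, D.DeltaHat⁆, D.DeltaHat⁆).topologicalClosure →
      D.Kdd = D.K → D.Sec2Hyps :=
  fun h => ThetaSetting.not_sec2Hyps_model₂Twist p
    (h (ThetaSetting.model₂Twist p) (ThetaSetting.model₂Twist_isEtThOrigin p) (hYcl_model₂Twist p)
      (model₂Twist_Kdd_eq p))

/-- **Joint satisfiability census for clause (b) in the presence of `hYcl`**: {root, guard, `hYcl`, "`K = K̈`"} has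
a model of clause (b) (`model₂ p`, abc-iut-L2-d1's `model₂_sec2Hyps`) and a model of its negation (`model₂Twist p`).
[cite: MochizukiEtTh2009, §1 p.13] -/
theorem _root_.Literature.AnabelianGeometry.EtaleTheta.ThetaSetting.kerClause_independent_hYcl :
    (∃ D : ThetaSetting p, D.IsEtThOrigin ∧
      (D.DtpY.map D.toHat.toMonoidHom).topologicalClosure ≤
        D.DtpY.map D.toHat.toMonoidHom ⊔ (⁅⁅D.DeltaHat, D.DeltaHat⁆, D.DeltaHat⁆).topologicalClosure ∧
      D.Kdd = D.K ∧ ∀ N, (D.thetaToEll.comp D.toTheta).ker ⊓ D.GtpY ≤ D.GtpYN N) ∧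
    ∃ D : ThetaSetting p, D.IsEtThOrigin ∧
      (D.DtpY.map D.toHat.toMonoidHom).topologicalClosure ≤
        D.DtpY.map D.toHat.toMonoidHom ⊔ (⁅⁅D.DeltaHat, D.DeltaHat⁆, D.DeltaHat⁆).topologicalClosure ∧
      D.Kdd = D.K ∧ ¬ ∀ N, (D.thetaToEll.comp D.toTheta).ker ⊓ D.GtpY ≤ D.GtpYN N :=
  ⟨⟨ThetaSetting.model₂ p, ThetaSetting.model₂_isEtThOrigin p, hYcl_model₂ p, model₂_Kdd_eq p,
      ker_toEllM₂_inf_GtpY_le_YN₂ p⟩,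
    ⟨ThetaSetting.model₂Twist p, ThetaSetting.model₂Twist_isEtThOrigin p, hYcl_model₂Twist p,
      model₂Twist_Kdd_eq p, not_ker_toEll_inf_GtpY_le_GtpYN_model₂Twist p⟩⟩

end Literature.AnabelianGeometry.EtaleTheta.SettingModel

end
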